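import Summits.QuantumFields.BalabanUV.Beta.GAN24.CombChargeRowsOfFiveContactLetters
import Summits.QuantumFields.BalabanUV.Beta.GAN24.CombContactCauchyAssemblyHolds

/-!
# `BalabanUV.Beta.GAN24.CombChargeRowsOfBornContactLetters` — binder row G-an2-4 ∕ (CONV-C), TRANSFER-III, the (III′) (C)-row's END at row D1's literal of record:
# **THE G-an2-4 END ⟸ THE FOUR BORN CONTACT LETTERS `hCg hPc hCv hPcV` — THE WILSON SECTOR OF (b) IS OFF THE BILL** — this gen's S54b `CombChargeRowsOfFiveContactLetters`
# (END ⟸ five letters) with its FIRST binder, the (III′) Wilson contact RATE END `hCTd`, DISCHARGED BY NAME by gan24-formalise-leaf-01 g89's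
# `CombContactCauchyAssemblyHolds.exists_comb_contact_supRate_ctr` (from `2 ≤ Lc` alone; their INTENT-7 [LEAF01-G89-INTENT-7] l.67989).  Statement = S54b's with the `hCTd` binder
# deleted, every other token VERBATIM (road-P2 M.105's born binders at `cΛt := cΛ`).  (G-an2-4 ∕ (CONV-C) OWNER `b2b-balaban-gan24-p1`, gen 54; journal [GAN24P1-G54-W-3])

NOT IN PRINT; OUR BOOKKEEPING ([folklore] one application BY NAME; 0 `def`, 0 cited fact, 0 `def … : Prop`, 0 sorry).  The four born hypotheses are OPEN (leaf-01's ∕ road-P2's lane: the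
(III′) twins of the (E) born-Λ ∕ born-V contact chains at the conjugated legs; leg side: this gen's W54c `CombBornLambdaGaugeBlind`).  HONEST FRAMING (cell contract, verbatim): «discharging
`BetaPertH` makes Bałaban's UV stability UNCONDITIONAL — a real constructive-QFT result; it is NOT the continuum limit and NOT the Clay problem.»  HONEST DEPENDENCY (verbatim): «continuum
YM on T⁴ ⇐ BetaPertH ∧ nine spine estimates (0/9 proved); BetaPertH ⇐ (D1) ∧ (D4) ∧ CAP+tail; G-an2-4 gates asym, D1 and NE2/3/4.»  NOT (b) by itself; NEVER «G-an2-4 closed» as (CONV-C);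
NOT D1, NOT `BetaPertH`, NOT continuum, NOT Clay.  2026-08-28; no existing file touched.
-/

noncomputable section

open Literature.MathematicalPhysics.QuantumFieldTheory
open Literature.MathematicalPhysics.QuantumFieldTheory.Balaban1983to89
open Literature.MathematicalPhysics.QuantumFieldTheory.Balaban1983to89.Beta
open scoped BigOperators
open RemainderConstAllScales (AllScalesSeq)
open OneStepResolventKernel (Fib LocStencil)
open OneStepKernelFamily (TbalOf D1Drift)
open AffineAveraging (Site box toSite)
open AveragingContoursRooted (ctr ctrOff ctrOff_mem_box)
open B4ContourShift (supNorm)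
open ExpKernelCalculus (MKer)
open StepJetData (wilsonA)
open BalabanCompositeJets (respStep)
open Summit.QuantumFields.BalabanUV.Beta.HessKerDressedUnits (unitS)
open Summit.QuantumFields.BalabanUV.Beta.SymCorrectorKernel (psiKS)
open Summit.QuantumFields.BalabanUV.Beta.SymmetrisedStepJets (SymTables)
open Summit.QuantumFields.BalabanUV.Beta.SymAveragingHessianCounts (symHessFFAt symVhSAt)
open Summit.QuantumFields.BalabanUV.Beta.CombChartStepJets (ScombOf)
open Summit.QuantumFields.BalabanUV.Beta.CombChartJointEnd (JsB12CombShSym)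
open Summit.QuantumFields.BalabanUV.Beta.SymSecondOrderTablesAn1 (symTablesAn1S2)
open Summit.QuantumFields.BalabanUV.Beta.GAN24.CombesThomas (sfStep smStep KStepUnit SupBound)
open Summit.QuantumFields.BalabanUV.Beta.GAN24.Push4 (legComp IsFF)
open Summit.QuantumFields.BalabanUV.Beta.GAN24.Push4Iter (legChain)
open Summit.QuantumFields.BalabanUV.Beta.GAN24.Push3 (push₃)
open Summit.QuantumFields.BalabanUV.Beta.GAN24.AffineUnroll (transport)
open Summit.QuantumFields.BalabanUV.Beta.GAN24.SrecLinearPartEq (colM rowMM reslot)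
open Summit.QuantumFields.BalabanUV.Beta.GAN24.RespStepBmDecompExact (respStepBmSeq)
open Summit.QuantumFields.BalabanUV.Beta.GAN24.CombBornSector (combFreshAt combUnitStepMap)
open Summit.QuantumFields.BalabanUV.Beta.GAN24.CombSRowsOfContactLetters (exists_hS_hSall_ScombOf_of_contactLetters)
open Summit.QuantumFields.BalabanUV.Beta.GAN24.CombChargeRowsOfFiveContactLetters (exists_allScalesSeq_JsB12CombShSym_an1_of_fiveContactLetters d1Drift_JsB12CombShSym_an1_iff_lim_eq_of_fiveContactLetters)
open Summit.QuantumFields.BalabanUV.Beta.GAN24.CombContactCauchyAssemblyHolds (exists_comb_contact_supRate_ctr)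

namespace Summit.QuantumFields.BalabanUV.Beta.GAN24.CombChargeRowsOfBornContactLetters

variable {Lc : ℕ} [NeZero Lc]

set_option maxHeartbeats 1000000 in
/-- NOT IN PRINT; OUR BOOKKEEPING.  §1 **THE G-an2-4 END AT ROW D1's LITERAL OF RECORD (III′) ⟸ THE FOUR BORN CONTACT LETTERS** (S54b §1 with `hCTd := leaf-01 g89's `exists_comb_contact_supRate_ctr hLc2``) (`Odd Lc`, `2 ≤ Lc`, `2 ≤ N`, `cΛ·Lc⁴ = 2`,
`cB = −Lc¹²∕4`): W54b `exists_allScalesSeq_JsB12CombShSym_an1_of_sRows` ∘ road-P2 M.104 `exists_hS_hSall_ScombOf_of_contactLetters` (record letters by `rfl` as in M.105). -/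
theorem exists_allScalesSeq_JsB12CombShSym_an1_of_bornContactLetters (hLc : Odd Lc) (hLc2 : 2 ≤ Lc) {N : ℕ} (hN : 2 ≤ N) {cΛ cB : ℝ} (hΛ : cΛ * (Lc : ℝ) ^ 4 = 2)
    (hcB : cB = -((Lc : ℝ) ^ 12 / 4)) {p q : ℕ}
    (hCg : ∃ C θ δ : ℝ, 0 ≤ C ∧ 0 ≤ θ ∧ θ < 1 ∧ 0 < δ ∧ ∀ k i : ℕ, i < k →
      LocStencil (fun κ' u' => ((Lc : ℝ) ^ 4 * (Lc : ℝ) ^ (2 * (3 + 1))) ^ (k - i) •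
        (push₃ (legChain (fun j => legComp (fun α x κ u => psiKS (ctrOff (3 + 1) Lc) Lc u x (Sum.inl κ) (Sum.inl α)) (respStepBmSeq (d := 3) (ctr (3 + 1) Lc) Lc j)) i (k - 1 - i)) (legChain (fun j => legComp (fun α x κ u => psiKS (ctrOff (3 + 1) Lc) Lc u x (Sum.inl κ) (Sum.inl α)) (respStepBmSeq (d := 3) (ctr (3 + 1) Lc) Lc j)) i (k - 1 - i))
              (legChain (fun j => legComp (fun α x κ u => psiKS (ctrOff (3 + 1) Lc) Lc u x (Sum.inl κ) (Sum.inl α)) (respStepBmSeq (d := 3) (ctr (3 + 1) Lc) Lc j)) i (k - 1 - i))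
              (unitS (sfStep Lc i) (smStep 3 Lc i) (combFreshAt (symTablesAn1S2 3 Lc cΛ) 0 cΛ i)) κ' u'
          - push₃ (respStep (d := 3) (Lc ^ i) (Lc ^ k)) (respStep (d := 3) (Lc ^ i) (Lc ^ k)) (respStep (d := 3) (Lc ^ i) (Lc ^ k))
              (unitS (sfStep Lc i) (smStep 3 Lc i) (combFreshAt (symTablesAn1S2 3 Lc cΛ) 0 cΛ i)) κ' u')) (C * ((((k - i : ℕ) : ℝ)) ^ p * θ ^ (k - i))) δ)
    (hPc : ∃ CPc Θc : ℝ, 0 ≤ CPc ∧ 0 ≤ Θc ∧ Θc < 1 ∧ ∀ k i : ℕ, 1 ≤ i → i < k → ∀ κ u,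
      SupBound
        (((fun κ' u' => ((Lc : ℝ) ^ 4 * (Lc : ℝ) ^ (2 * (3 + 1))) ^ (k - i) •
            (push₃ (legChain (fun j => legComp (fun α x κ u => psiKS (ctrOff (3 + 1) Lc) Lc u x (Sum.inl κ) (Sum.inl α)) (respStepBmSeq (d := 3) (ctr (3 + 1) Lc) Lc j)) (i + 1) (k - 1 - i)) (legChain (fun j => legComp (fun α x κ u => psiKS (ctrOff (3 + 1) Lc) Lc u x (Sum.inl κ) (Sum.inl α)) (respStepBmSeq (d := 3) (ctr (3 + 1) Lc) Lc j)) (i + 1) (k - 1 - i))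
              (legChain (fun j => legComp (fun α x κ u => psiKS (ctrOff (3 + 1) Lc) Lc u x (Sum.inl κ) (Sum.inl α)) (respStepBmSeq (d := 3) (ctr (3 + 1) Lc) Lc j)) (i + 1) (k - 1 - i))
              (unitS (sfStep Lc (i + 1)) (smStep 3 Lc (i + 1)) (combFreshAt (symTablesAn1S2 3 Lc cΛ) 0 cΛ (i + 1))) κ' u'
              - push₃ (respStep (d := 3) (Lc ^ (i + 1)) (Lc ^ (k + 1))) (respStep (d := 3) (Lc ^ (i + 1)) (Lc ^ (k + 1))) (respStep (d := 3) (Lc ^ (i + 1)) (Lc ^ (k + 1)))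
              (unitS (sfStep Lc (i + 1)) (smStep 3 Lc (i + 1)) (combFreshAt (symTablesAn1S2 3 Lc cΛ) 0 cΛ (i + 1))) κ' u'))
          - fun κ' u' => ((Lc : ℝ) ^ 4 * (Lc : ℝ) ^ (2 * (3 + 1))) ^ (k - i) •
            (push₃ (legChain (fun j => legComp (fun α x κ u => psiKS (ctrOff (3 + 1) Lc) Lc u x (Sum.inl κ) (Sum.inl α)) (respStepBmSeq (d := 3) (ctr (3 + 1) Lc) Lc j)) i (k - 1 - i)) (legChain (fun j => legComp (fun α x κ u => psiKS (ctrOff (3 + 1) Lc) Lc u x (Sum.inl κ) (Sum.inl α)) (respStepBmSeq (d := 3) (ctr (3 + 1) Lc) Lc j)) i (k - 1 - i))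
              (legChain (fun j => legComp (fun α x κ u => psiKS (ctrOff (3 + 1) Lc) Lc u x (Sum.inl κ) (Sum.inl α)) (respStepBmSeq (d := 3) (ctr (3 + 1) Lc) Lc j)) i (k - 1 - i))
              (unitS (sfStep Lc i) (smStep 3 Lc i) (combFreshAt (symTablesAn1S2 3 Lc cΛ) 0 cΛ i)) κ' u'
              - push₃ (respStep (d := 3) (Lc ^ i) (Lc ^ k)) (respStep (d := 3) (Lc ^ i) (Lc ^ k)) (respStep (d := 3) (Lc ^ i) (Lc ^ k))
              (unitS (sfStep Lc i) (smStep 3 Lc i) (combFreshAt (symTablesAn1S2 3 Lc cΛ) 0 cΛ i)) κ' u')) κ u)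
        (CPc * ((((k - i : ℕ) : ℝ)) ^ q * Θc ^ k)))
    (hCv : ∃ C θ δ : ℝ, 0 ≤ C ∧ 0 ≤ θ ∧ θ < 1 ∧ 0 < δ ∧ ∀ k i : ℕ, i < k →
      LocStencil (transport (combUnitStepMap Lc ((Lc : ℝ) ^ 4)) (i + 1) (k - 1 - i) (combUnitStepMap Lc ((Lc : ℝ) ^ 4) i (fun κ u => (-((Lc : ℝ) ^ 8 / 2)) • (symTablesAn1S2 3 Lc cΛ).V κ u))
        - (fun κ' u' => ((Lc : ℝ) ^ 4 * (Lc : ℝ) ^ (2 * (3 + 1))) ^ (k - i) •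
          push₃ (respStep (d := 3) (Lc ^ (i + 1)) (Lc ^ k)) (respStep (d := 3) (Lc ^ (i + 1)) (Lc ^ k)) (respStep (d := 3) (Lc ^ (i + 1)) (Lc ^ k))
            (fun κ u => -(push₃ (-respStep (d := 3) (Lc ^ i) (Lc ^ (i + 1))) (colM (KStepUnit (d := 3) Lc i) Lc)
                  (respStep (d := 3) (Lc ^ i) (Lc ^ (i + 1))) (reslot Sum.inl Sum.inr fun κ u => (-((Lc : ℝ) ^ 8 / 2)) • SymTables.V (symTablesAn1S2 3 Lc cΛ) κ u) κ u
              + push₃ (rowMM (KStepUnit (d := 3) Lc i) Lc) (respStep (d := 3) (Lc ^ i) (Lc ^ (i + 1)))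
                  (respStep (d := 3) (Lc ^ i) (Lc ^ (i + 1))) (reslot Sum.inr Sum.inl fun κ u => (-((Lc : ℝ) ^ 8 / 2)) • SymTables.V (symTablesAn1S2 3 Lc cΛ) κ u) κ u)) κ' u')) (C * ((((k - i : ℕ) : ℝ)) ^ p * θ ^ (k - i))) δ)
    (hPcV : ∃ CPc Θc : ℝ, 0 ≤ CPc ∧ 0 ≤ Θc ∧ Θc < 1 ∧ ∀ k i : ℕ, 1 ≤ i → i < k → ∀ κ u,
      SupBound
        (((transport (combUnitStepMap Lc ((Lc : ℝ) ^ 4)) (i + 1 + 1) (k - 1 - i) (combUnitStepMap Lc ((Lc : ℝ) ^ 4) (i + 1) (fun κ u => (-((Lc : ℝ) ^ 8 / 2)) • (symTablesAn1S2 3 Lc cΛ).V κ u))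
            - (fun κ' u' => ((Lc : ℝ) ^ 4 * (Lc : ℝ) ^ (2 * (3 + 1))) ^ (k - i) •
          push₃ (respStep (d := 3) (Lc ^ ((i + 1) + 1)) (Lc ^ (k + 1))) (respStep (d := 3) (Lc ^ ((i + 1) + 1)) (Lc ^ (k + 1))) (respStep (d := 3) (Lc ^ ((i + 1) + 1)) (Lc ^ (k + 1)))
            (fun κ u => -(push₃ (-respStep (d := 3) (Lc ^ (i + 1)) (Lc ^ ((i + 1) + 1))) (colM (KStepUnit (d := 3) Lc (i + 1)) Lc)
                  (respStep (d := 3) (Lc ^ (i + 1)) (Lc ^ ((i + 1) + 1))) (reslot Sum.inl Sum.inr fun κ u => (-((Lc : ℝ) ^ 8 / 2)) • SymTables.V (symTablesAn1S2 3 Lc cΛ) κ u) κ u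
              + push₃ (rowMM (KStepUnit (d := 3) Lc (i + 1)) Lc) (respStep (d := 3) (Lc ^ (i + 1)) (Lc ^ ((i + 1) + 1)))
                  (respStep (d := 3) (Lc ^ (i + 1)) (Lc ^ ((i + 1) + 1))) (reslot Sum.inr Sum.inl fun κ u => (-((Lc : ℝ) ^ 8 / 2)) • SymTables.V (symTablesAn1S2 3 Lc cΛ) κ u) κ u)) κ' u'))
          - (transport (combUnitStepMap Lc ((Lc : ℝ) ^ 4)) (i + 1) (k - 1 - i) (combUnitStepMap Lc ((Lc : ℝ) ^ 4) i (fun κ u => (-((Lc : ℝ) ^ 8 / 2)) • (symTablesAn1S2 3 Lc cΛ).V κ u))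
            - (fun κ' u' => ((Lc : ℝ) ^ 4 * (Lc : ℝ) ^ (2 * (3 + 1))) ^ (k - i) •
          push₃ (respStep (d := 3) (Lc ^ (i + 1)) (Lc ^ k)) (respStep (d := 3) (Lc ^ (i + 1)) (Lc ^ k)) (respStep (d := 3) (Lc ^ (i + 1)) (Lc ^ k))
            (fun κ u => -(push₃ (-respStep (d := 3) (Lc ^ i) (Lc ^ (i + 1))) (colM (KStepUnit (d := 3) Lc i) Lc)
                  (respStep (d := 3) (Lc ^ i) (Lc ^ (i + 1))) (reslot Sum.inl Sum.inr fun κ u => (-((Lc : ℝ) ^ 8 / 2)) • SymTables.V (symTablesAn1S2 3 Lc cΛ) κ u) κ u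
              + push₃ (rowMM (KStepUnit (d := 3) Lc i) Lc) (respStep (d := 3) (Lc ^ i) (Lc ^ (i + 1)))
                  (respStep (d := 3) (Lc ^ i) (Lc ^ (i + 1))) (reslot Sum.inr Sum.inl fun κ u => (-((Lc : ℝ) ^ 8 / 2)) • SymTables.V (symTablesAn1S2 3 Lc cΛ) κ u) κ u)) κ' u'))) κ u)
        (CPc * ((((k - i : ℕ) : ℝ)) ^ q * Θc ^ k)))
    (μ ν : Fin 4) :
    ∃ κ θ : ℝ, 0 ≤ θ ∧ θ < 1 ∧ AllScalesSeq (fun j => B12Beta.secondMoment (TbalOf Lc (JsB12CombShSym hLc N (symTablesAn1S2 3 Lc cΛ) cΛ cB) j) μ ν) κ θ := by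
  exact exists_allScalesSeq_JsB12CombShSym_an1_of_fiveContactLetters hLc hLc2 hN hΛ hcB (exists_comb_contact_supRate_ctr hLc2) hCg hPc hCv hPcV μ ν

set_option maxHeartbeats 1000000 in
/-- NOT IN PRINT; OUR BOOKKEEPING.  §2 **ROW D1's READING AT ITS LITERAL OF RECORD ⟸ THE FOUR BORN CONTACT LETTERS** (S54b §2, `hCTd` supplied) — M.105 with the `T₂` pair `hT₂ ∕ hT₂d` GONE
(the VALUE `lim β = stepBal Nc Lc` is row D1's and is NOT proved). -/
theorem d1Drift_JsB12CombShSym_an1_iff_lim_eq_of_bornContactLetters (hLc : Odd Lc) (hLc2 : 2 ≤ Lc) {N : ℕ} (hN : 2 ≤ N) {cΛ cB : ℝ} (hΛ : cΛ * (Lc : ℝ) ^ 4 = 2)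
    (hcB : cB = -((Lc : ℝ) ^ 12 / 4)) {p q : ℕ}
    (hCg : ∃ C θ δ : ℝ, 0 ≤ C ∧ 0 ≤ θ ∧ θ < 1 ∧ 0 < δ ∧ ∀ k i : ℕ, i < k →
      LocStencil (fun κ' u' => ((Lc : ℝ) ^ 4 * (Lc : ℝ) ^ (2 * (3 + 1))) ^ (k - i) •
        (push₃ (legChain (fun j => legComp (fun α x κ u => psiKS (ctrOff (3 + 1) Lc) Lc u x (Sum.inl κ) (Sum.inl α)) (respStepBmSeq (d := 3) (ctr (3 + 1) Lc) Lc j)) i (k - 1 - i)) (legChain (fun j => legComp (fun α x κ u => psiKS (ctrOff (3 + 1) Lc) Lc u x (Sum.inl κ) (Sum.inl α)) (respStepBmSeq (d := 3) (ctr (3 + 1) Lc) Lc j)) i (k - 1 - i))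
              (legChain (fun j => legComp (fun α x κ u => psiKS (ctrOff (3 + 1) Lc) Lc u x (Sum.inl κ) (Sum.inl α)) (respStepBmSeq (d := 3) (ctr (3 + 1) Lc) Lc j)) i (k - 1 - i))
              (unitS (sfStep Lc i) (smStep 3 Lc i) (combFreshAt (symTablesAn1S2 3 Lc cΛ) 0 cΛ i)) κ' u'
          - push₃ (respStep (d := 3) (Lc ^ i) (Lc ^ k)) (respStep (d := 3) (Lc ^ i) (Lc ^ k)) (respStep (d := 3) (Lc ^ i) (Lc ^ k))
              (unitS (sfStep Lc i) (smStep 3 Lc i) (combFreshAt (symTablesAn1S2 3 Lc cΛ) 0 cΛ i)) κ' u')) (C * ((((k - i : ℕ) : ℝ)) ^ p * θ ^ (k - i))) δ)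
    (hPc : ∃ CPc Θc : ℝ, 0 ≤ CPc ∧ 0 ≤ Θc ∧ Θc < 1 ∧ ∀ k i : ℕ, 1 ≤ i → i < k → ∀ κ u,
      SupBound
        (((fun κ' u' => ((Lc : ℝ) ^ 4 * (Lc : ℝ) ^ (2 * (3 + 1))) ^ (k - i) •
            (push₃ (legChain (fun j => legComp (fun α x κ u => psiKS (ctrOff (3 + 1) Lc) Lc u x (Sum.inl κ) (Sum.inl α)) (respStepBmSeq (d := 3) (ctr (3 + 1) Lc) Lc j)) (i + 1) (k - 1 - i)) (legChain (fun j => legComp (fun α x κ u => psiKS (ctrOff (3 + 1) Lc) Lc u x (Sum.inl κ) (Sum.inl α)) (respStepBmSeq (d := 3) (ctr (3 + 1) Lc) Lc j)) (i + 1) (k - 1 - i))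
              (legChain (fun j => legComp (fun α x κ u => psiKS (ctrOff (3 + 1) Lc) Lc u x (Sum.inl κ) (Sum.inl α)) (respStepBmSeq (d := 3) (ctr (3 + 1) Lc) Lc j)) (i + 1) (k - 1 - i))
              (unitS (sfStep Lc (i + 1)) (smStep 3 Lc (i + 1)) (combFreshAt (symTablesAn1S2 3 Lc cΛ) 0 cΛ (i + 1))) κ' u'
              - push₃ (respStep (d := 3) (Lc ^ (i + 1)) (Lc ^ (k + 1))) (respStep (d := 3) (Lc ^ (i + 1)) (Lc ^ (k + 1))) (respStep (d := 3) (Lc ^ (i + 1)) (Lc ^ (k + 1)))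
              (unitS (sfStep Lc (i + 1)) (smStep 3 Lc (i + 1)) (combFreshAt (symTablesAn1S2 3 Lc cΛ) 0 cΛ (i + 1))) κ' u'))
          - fun κ' u' => ((Lc : ℝ) ^ 4 * (Lc : ℝ) ^ (2 * (3 + 1))) ^ (k - i) •
            (push₃ (legChain (fun j => legComp (fun α x κ u => psiKS (ctrOff (3 + 1) Lc) Lc u x (Sum.inl κ) (Sum.inl α)) (respStepBmSeq (d := 3) (ctr (3 + 1) Lc) Lc j)) i (k - 1 - i)) (legChain (fun j => legComp (fun α x κ u => psiKS (ctrOff (3 + 1) Lc) Lc u x (Sum.inl κ) (Sum.inl α)) (respStepBmSeq (d := 3) (ctr (3 + 1) Lc) Lc j)) i (k - 1 - i))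
              (legChain (fun j => legComp (fun α x κ u => psiKS (ctrOff (3 + 1) Lc) Lc u x (Sum.inl κ) (Sum.inl α)) (respStepBmSeq (d := 3) (ctr (3 + 1) Lc) Lc j)) i (k - 1 - i))
              (unitS (sfStep Lc i) (smStep 3 Lc i) (combFreshAt (symTablesAn1S2 3 Lc cΛ) 0 cΛ i)) κ' u'
              - push₃ (respStep (d := 3) (Lc ^ i) (Lc ^ k)) (respStep (d := 3) (Lc ^ i) (Lc ^ k)) (respStep (d := 3) (Lc ^ i) (Lc ^ k))
              (unitS (sfStep Lc i) (smStep 3 Lc i) (combFreshAt (symTablesAn1S2 3 Lc cΛ) 0 cΛ i)) κ' u')) κ u)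
        (CPc * ((((k - i : ℕ) : ℝ)) ^ q * Θc ^ k)))
    (hCv : ∃ C θ δ : ℝ, 0 ≤ C ∧ 0 ≤ θ ∧ θ < 1 ∧ 0 < δ ∧ ∀ k i : ℕ, i < k →
      LocStencil (transport (combUnitStepMap Lc ((Lc : ℝ) ^ 4)) (i + 1) (k - 1 - i) (combUnitStepMap Lc ((Lc : ℝ) ^ 4) i (fun κ u => (-((Lc : ℝ) ^ 8 / 2)) • (symTablesAn1S2 3 Lc cΛ).V κ u))
        - (fun κ' u' => ((Lc : ℝ) ^ 4 * (Lc : ℝ) ^ (2 * (3 + 1))) ^ (k - i) •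
          push₃ (respStep (d := 3) (Lc ^ (i + 1)) (Lc ^ k)) (respStep (d := 3) (Lc ^ (i + 1)) (Lc ^ k)) (respStep (d := 3) (Lc ^ (i + 1)) (Lc ^ k))
            (fun κ u => -(push₃ (-respStep (d := 3) (Lc ^ i) (Lc ^ (i + 1))) (colM (KStepUnit (d := 3) Lc i) Lc)
                  (respStep (d := 3) (Lc ^ i) (Lc ^ (i + 1))) (reslot Sum.inl Sum.inr fun κ u => (-((Lc : ℝ) ^ 8 / 2)) • SymTables.V (symTablesAn1S2 3 Lc cΛ) κ u) κ u
              + push₃ (rowMM (KStepUnit (d := 3) Lc i) Lc) (respStep (d := 3) (Lc ^ i) (Lc ^ (i + 1)))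
                  (respStep (d := 3) (Lc ^ i) (Lc ^ (i + 1))) (reslot Sum.inr Sum.inl fun κ u => (-((Lc : ℝ) ^ 8 / 2)) • SymTables.V (symTablesAn1S2 3 Lc cΛ) κ u) κ u)) κ' u')) (C * ((((k - i : ℕ) : ℝ)) ^ p * θ ^ (k - i))) δ)
    (hPcV : ∃ CPc Θc : ℝ, 0 ≤ CPc ∧ 0 ≤ Θc ∧ Θc < 1 ∧ ∀ k i : ℕ, 1 ≤ i → i < k → ∀ κ u,
      SupBound
        (((transport (combUnitStepMap Lc ((Lc : ℝ) ^ 4)) (i + 1 + 1) (k - 1 - i) (combUnitStepMap Lc ((Lc : ℝ) ^ 4) (i + 1) (fun κ u => (-((Lc : ℝ) ^ 8 / 2)) • (symTablesAn1S2 3 Lc cΛ).V κ u))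
            - (fun κ' u' => ((Lc : ℝ) ^ 4 * (Lc : ℝ) ^ (2 * (3 + 1))) ^ (k - i) •
          push₃ (respStep (d := 3) (Lc ^ ((i + 1) + 1)) (Lc ^ (k + 1))) (respStep (d := 3) (Lc ^ ((i + 1) + 1)) (Lc ^ (k + 1))) (respStep (d := 3) (Lc ^ ((i + 1) + 1)) (Lc ^ (k + 1)))
            (fun κ u => -(push₃ (-respStep (d := 3) (Lc ^ (i + 1)) (Lc ^ ((i + 1) + 1))) (colM (KStepUnit (d := 3) Lc (i + 1)) Lc)
                  (respStep (d := 3) (Lc ^ (i + 1)) (Lc ^ ((i + 1) + 1))) (reslot Sum.inl Sum.inr fun κ u => (-((Lc : ℝ) ^ 8 / 2)) • SymTables.V (symTablesAn1S2 3 Lc cΛ) κ u) κ u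
              + push₃ (rowMM (KStepUnit (d := 3) Lc (i + 1)) Lc) (respStep (d := 3) (Lc ^ (i + 1)) (Lc ^ ((i + 1) + 1)))
                  (respStep (d := 3) (Lc ^ (i + 1)) (Lc ^ ((i + 1) + 1))) (reslot Sum.inr Sum.inl fun κ u => (-((Lc : ℝ) ^ 8 / 2)) • SymTables.V (symTablesAn1S2 3 Lc cΛ) κ u) κ u)) κ' u'))
          - (transport (combUnitStepMap Lc ((Lc : ℝ) ^ 4)) (i + 1) (k - 1 - i) (combUnitStepMap Lc ((Lc : ℝ) ^ 4) i (fun κ u => (-((Lc : ℝ) ^ 8 / 2)) • (symTablesAn1S2 3 Lc cΛ).V κ u))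
            - (fun κ' u' => ((Lc : ℝ) ^ 4 * (Lc : ℝ) ^ (2 * (3 + 1))) ^ (k - i) •
          push₃ (respStep (d := 3) (Lc ^ (i + 1)) (Lc ^ k)) (respStep (d := 3) (Lc ^ (i + 1)) (Lc ^ k)) (respStep (d := 3) (Lc ^ (i + 1)) (Lc ^ k))
            (fun κ u => -(push₃ (-respStep (d := 3) (Lc ^ i) (Lc ^ (i + 1))) (colM (KStepUnit (d := 3) Lc i) Lc)
                  (respStep (d := 3) (Lc ^ i) (Lc ^ (i + 1))) (reslot Sum.inl Sum.inr fun κ u => (-((Lc : ℝ) ^ 8 / 2)) • SymTables.V (symTablesAn1S2 3 Lc cΛ) κ u) κ u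
              + push₃ (rowMM (KStepUnit (d := 3) Lc i) Lc) (respStep (d := 3) (Lc ^ i) (Lc ^ (i + 1)))
                  (respStep (d := 3) (Lc ^ i) (Lc ^ (i + 1))) (reslot Sum.inr Sum.inl fun κ u => (-((Lc : ℝ) ^ 8 / 2)) • SymTables.V (symTablesAn1S2 3 Lc cΛ) κ u) κ u)) κ' u'))) κ u)
        (CPc * ((((k - i : ℕ) : ℝ)) ^ q * Θc ^ k)))
    (μ ν : Fin 4) (Nc : ℝ) :
    D1Drift Lc (JsB12CombShSym hLc N (symTablesAn1S2 3 Lc cΛ) cΛ cB) Nc μ ν ↔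
      RateCertificate.CauchyRate.lim (fun j => B12Beta.secondMoment (TbalOf Lc (JsB12CombShSym hLc N (symTablesAn1S2 3 Lc cΛ) cΛ cB) j) μ ν) =
        B12Normalization.stepBal Nc Lc := by
  exact d1Drift_JsB12CombShSym_an1_iff_lim_eq_of_fiveContactLetters hLc hLc2 hN hΛ hcB (exists_comb_contact_supRate_ctr hLc2) hCg hPc hCv hPcV μ ν Nc

end Summit.QuantumFields.BalabanUV.Beta.GAN24.CombChargeRowsOfBornContactLetters

end
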